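import Literature.IUT.HodgeArakelov.CohomologyLimitComap

/-!
# Transport of the cohomology limit `lim_K H¹(H|_K, A)` along an EQUALITY of coefficient actions `φ₁ = φ₂ : Π → G'`
# (identifying the cohomology of the decomposition groups of DIFFERENT labels through the common `G_v`-action on
# the cyclotome)

Companion (abc-iut cell, layer L6, seat abc-iut-w4-d004 gen 2; node IUTchII:Cor3.5(ii), junction hypothesis `hr`,
label-wise form) to `CohomologySystemOfContH1.lean` (abc-iut-L6-t1), `CohomologyLimitConj.lean` (abc-iut-w4-d043)
and `CohomologyLimitComap.lean` (abc-iut-w4-d004). S. Mochizuki, *Inter-universal Teichmüller theory II*, kurims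
manuscript (Dec. 2020), Cor. 3.5 (i)/(ii) pp. 94–95: the restrictions "to the decomposition groups `D^δ_{t,μ_-}`"
(Cor. 2.8 (i)) of the various labels `t` land in "`lim_{J_G} H¹(G_v(…)|_{J_G}, Π_μ(…))`", ONE module for all labels,
the copies being compared through "the inclusions `G_v(M^Θ_*) ↪ Π_{v▶}(M^Θ_*▶)` determined by the various choices of
the `D^δ_{t,μ_-}`" [cite: Mochizuki2012, Cor 3.5 (ii) p.95]. In the continuous-cohomology model the pull-back of
`lim_K H¹(Π_Ÿ|_K, A)` along the evaluation section `ι_t : G_v → Π` of label `t` (`h1LimComap`) is valued in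
`lim_{K₀} H¹(G_v ⊓ K₀, A)` computed with the coefficient action `φ ∘ ι_t` — which is the SAME homomorphism
`φ₀ : G_v → G'` for every label (the action of `Π` on the cyclotome `Π_μ ≅ Ẑ(1)` factors through `Π ↠ G_v`, of which
the `ι_t` are sections), but only PROPOSITIONALLY so. HERE: the transport `h1LimCongr (h : φ₁ = φ₂)` of the limit
along such an equality (an additive isomorphism, DEFINED by `Eq`-substitution), with its computation rules —
identity at `rfl`, compatibility with the conjugation action (`h1LimCongr_conj`, `h1LimCongr_symm_conj`), with the
maps to the limit (`h1LimCongr_h1Res`) and with top-level classes (`h1LimCongr_mem_range_toLim`), and the packaged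
multiplicative form (`h1LimCongrMul`). Elementary bookkeeping [cite: NeukirchSchmidtWingberg2008, I §5]; nothing
of [IUTchII] is asserted (claim key of the interface `Mochizuki2012`, D-0012 disputed; no side taken on
[IUTchIII] Cor. 3.12).
-/

namespace Literature.IUT.HodgeArakelov

open Literature.AnabelianGeometry.EtaleTheta CohomologySystemOfContH1

universe u

noncomputable section

variable {P : TopGroup.{u}} {G' : Type u} [Group G'] [TopologicalSpace G'] [IsTopologicalGroup G']
  {φ₁ φ₂ : P →* G'} (A : Subgroup G') [A.Normal] [IsMulCommutative A] (H : Subgroup P)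

/-- **Transport of `lim_K H¹(H ⊓ K, A)` along an equality `φ₁ = φ₂` of coefficient actions** (DEFINED by
substitution; the identity when the equality is `rfl`). Used to identify the targets `lim_{K₀} H¹(G_v ⊓ K₀, A)` of
the pull-backs along the evaluation sections of different labels, whose coefficient actions `φ ∘ ι_t` all equal
the common `G_v`-action `φ₀`. [cite: Mochizuki2012, Cor 3.5 (ii) p.95] -/
def h1LimCongr (h : φ₁ = φ₂) (J : Subgroup P) : h1Lim φ₁ A H J ≃+ h1Lim φ₂ A H J := by
  subst h
  exact AddEquiv.refl _

/-- At `rfl` the transport is the identity. [cite: NeukirchSchmidtWingberg2008, I §5] -/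
@[simp] theorem h1LimCongr_rfl_apply (J : Subgroup P) (x : h1Lim φ₁ A H J) :
    h1LimCongr A H (rfl : φ₁ = φ₁) J x = x := rfl

/-- The inverse transport is the transport along the symmetric equality. [cite: NeukirchSchmidtWingberg2008, I §5] -/
theorem h1LimCongr_symm (h : φ₁ = φ₂) (J : Subgroup P) :
    (h1LimCongr A H h J).symm = h1LimCongr A H h.symm J := by
  subst h
  rfl

/-- Transport commutes with the systems' maps `H1 J → H1 J'` (in particular with `toLim`).
[cite: NeukirchSchmidtWingberg2008, I §5] -/
theorem h1LimCongr_h1Res (h : φ₁ = φ₂) {J J' : Subgroup P} (hJ : J' ≤ J) (x : h1Lim φ₁ A H J) :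
    h1LimCongr A H h J' (h1Res φ₁ A H hJ x) = h1Res φ₂ A H hJ (h1LimCongr A H h J x) := by
  subst h
  rfl

/-- Transport carries TOP-LEVEL classes to top-level classes (the image of `toLim ⊤` is preserved).
[cite: NeukirchSchmidtWingberg2008, I §5] -/
theorem h1LimCongr_mem_range_toLim (h : φ₁ = φ₂) {y : h1Lim φ₁ A H ⊥}
    (hy : y ∈ Set.range ((cohomologySystemOfContH1 φ₁ A H).toLim ⊤)) :
    h1LimCongr A H h ⊥ y ∈ Set.range ((cohomologySystemOfContH1 φ₂ A H).toLim ⊤) := by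
  subst h
  exact hy

variable [H.Normal]

/-- **Transport intertwines the conjugation actions** (abc-iut-w4-d043 `h1LimConj` for `φ₁` and for `φ₂`).
[cite: NeukirchSchmidtWingberg2008, I §5] -/
theorem h1LimCongr_conj (h : φ₁ = φ₂) (σ : P) (y : h1Lim φ₁ A H ⊥) :
    h1LimCongr A H h ⊥ (h1LimConj φ₁ A H σ y) = h1LimConj φ₂ A H σ (h1LimCongr A H h ⊥ y) := by
  subst h
  rfl

/-- … and so does its inverse. [cite: NeukirchSchmidtWingberg2008, I §5] -/
theorem h1LimCongr_symm_conj (h : φ₁ = φ₂) (σ : P) (y : h1Lim φ₂ A H ⊥) :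
    (h1LimCongr A H h ⊥).symm (h1LimConj φ₂ A H σ y) = h1LimConj φ₁ A H σ ((h1LimCongr A H h ⊥).symm y) := by
  subst h
  rfl

/-- Transport intertwines the packaged actions `h1LimConjMulAut` (multiplicative form).
[cite: NeukirchSchmidtWingberg2008, I §5] -/
theorem h1LimCongr_conjMulAut (h : φ₁ = φ₂) (σ : P) (x : Multiplicative (h1Lim φ₁ A H ⊥)) :
    AddEquiv.toMultiplicative (h1LimCongr A H h ⊥) (h1LimConjMulAut φ₁ A H σ x) =
      h1LimConjMulAut φ₂ A H σ (AddEquiv.toMultiplicative (h1LimCongr A H h ⊥) x) := by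
  subst h
  rfl

end

end Literature.IUT.HodgeArakelov
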